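import Summits.CriticalPhenomena.PercolationContinuityZ3.Theorems.PercNearOneGluingNoHeavyLowerTailCubicThreePointApexSplit
import Mathlib.Tactic.Ring
import Mathlib.Tactic.Linarith
import Mathlib.Tactic.Positivity
import HarnessLib

/-!
# `NoHeavyLowerTail` (stmt-CriticalPhenomena-4575) — the SPARSE regime half `D₁ = Hb − (q−t)u₃n′` is CLOSED under parallel composition
# (exact 150-term product certificate in the refined cells; no regime hypothesis needed)

Support file (prover prim-ineq-gen-2 gen 10; `--supports stmt-CriticalPhenomena-4575`).  Pure real algebra, no definitions, no named facts, no sorries.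
Vocabulary: `CubicThreePointApex.D1` (`…ApexSplit`: `D₁ = Hb − (q−t)·u₃·n′`), `CubicThreePointTerminal.{AG, Hb}`; refined cells (apex `a`)
`(W, N′, U₁, U₂, U₃, N, M)` with `q = W + N′`, `t = N + M`, `n′ = N′` (`= P(a|b|c ∧ V(C_a) separates b,c)`), `n = N` (`= P(abc ∧ b≁c in ω∖a)`).

The REGIME PAIR (this seat's target; ⟹ SF3-Hmax) is `{t ≥ q ⇒ D₂ ≥ 0} ∧ {q ≥ t ⇒ D₁ ≥ 0}`.  Here: the class `{cells ≥ 0, AG ≥ 0, Hb ≥ 0, D₁ ≥ 0}` of refined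
three-point laws — which contains every SPARSE law satisfying the regime pair (there `Hb ≥ D₁ ≥ 0`) — is closed under PARALLEL COMPOSITION (join at the three
terminals; refined join map as in `…RegimeShadowJoin`: `zN′ = N′N₂′`, `zW = qQ − N′N₂′`, `zUᵢ = q vᵢ + uᵢ Q + uᵢ vᵢ`, `zM` = `T`-pairs with a factor in `{U₃, M}`,
`zN` = the other `T`-pairs), WITHOUT any regime hypothesis on the composite (which is typically dense).  Certificate: `D₁(z) = Σ_k c_k g_k(x) h_k(y)`, `c_k ∈ ℕ`,
`g, h ∈ {cell monomials, D₁, Hb, AG (× cells)}` (150 terms; LP over all bidegree-(3,3) products incl. unused regime generators `(q−t)·…`, kit j095944;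
exact; verified here by `ring`).  Companion facts (memo run/shared/lean/prim/prim-ineq-gen-2/SHADOW-S5.md §13): the dense half `D₂` and `Ha` are join-closed for dense
factors with float LP certificates (exact rationalisation pending at filing); the cubic shadow `S₅` is join-closed (`Shad_join_nonneg`, 562 terms).
-/

namespace Summit.CriticalPhenomena.PercolationContinuityZ3.Theorems

namespace CubicThreePointApex

open CubicThreePointTerminal CubicThreePointSharp

set_option maxHeartbeats 40000000 in
set_option maxRecDepth 100000 in
/-- **`{D₁ ≥ 0, Hb ≥ 0, AG ≥ 0}` is closed under parallel composition** (refined join; hypotheses on the two factors only). [this work] -/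
theorem D1_join_nonneg {W N' U₁ U₂ U₃ N M W₂ N₂' V₁ V₂ V₃ N₂ M₂ zW zN' zU₁ zU₂ zU₃ zN zM : ℝ}
    (h0x : 0 ≤ W) (h1x : 0 ≤ N') (h2x : 0 ≤ U₁) (h3x : 0 ≤ U₂) (h4x : 0 ≤ U₃) (h5x : 0 ≤ N) (h6x : 0 ≤ M) (h0y : 0 ≤ W₂) (h1y : 0 ≤ N₂') (h2y : 0 ≤ V₁) (h3y : 0 ≤ V₂) (h4y : 0 ≤ V₃) (h5y : 0 ≤ N₂) (h6y : 0 ≤ M₂)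
    (hAGx : 0 ≤ AG (W + N') U₁ U₂ U₃ (N + M)) (hD1x : 0 ≤ D1 (W + N') U₁ U₂ U₃ (N + M) N') (hHbx : 0 ≤ Hb (W + N') U₁ U₂ U₃ (N + M)) (hAGy : 0 ≤ AG (W₂ + N₂') V₁ V₂ V₃ (N₂ + M₂)) (hD1y : 0 ≤ D1 (W₂ + N₂') V₁ V₂ V₃ (N₂ + M₂) N₂') (hHby : 0 ≤ Hb (W₂ + N₂') V₁ V₂ V₃ (N₂ + M₂))
    (hzW : zW = W * W₂ + W * N₂' + N' * W₂)
    (hzNp : zN' = N' * N₂')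
    (hzU₁ : zU₁ = W * V₁ + N' * V₁ + U₁ * W₂ + U₁ * N₂' + U₁ * V₁)
    (hzU₂ : zU₂ = W * V₂ + N' * V₂ + U₂ * W₂ + U₂ * N₂' + U₂ * V₂)
    (hzU₃ : zU₃ = W * V₃ + N' * V₃ + U₃ * W₂ + U₃ * N₂' + U₃ * V₃)
    (hzN : zN = W * N₂ + N' * N₂ + U₁ * V₂ + U₁ * N₂ + U₂ * V₁ + U₂ * N₂ + N * W₂ + N * N₂' + N * V₁ + N * V₂ + N * N₂)
    (hzM : zM = W * M₂ + N' * M₂ + U₁ * V₃ + U₁ * M₂ + U₂ * V₃ + U₂ * M₂ + U₃ * V₁ + U₃ * V₂ + U₃ * N₂ + U₃ * M₂ + N * V₃ + N * M₂ + M * W₂ + M * N₂' + M * V₁ + M * V₂ + M * V₃ + M * N₂ + M * M₂) :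
    0 ≤ D1 (zW + zN') zU₁ zU₂ zU₃ (zN + zM) zN' := by
  have key : 1 * D1 (zW + zN') zU₁ zU₂ zU₃ (zN + zM) zN' =
        (AG (W + N') U₁ U₂ U₃ (N + M) * W) * (Hb (W₂ + N₂') V₁ V₂ V₃ (N₂ + M₂))
        + (AG (W + N') U₁ U₂ U₃ (N + M) * N') * (D1 (W₂ + N₂') V₁ V₂ V₃ (N₂ + M₂) N₂')
        + (AG (W + N') U₁ U₂ U₃ (N + M) * N') * ((N₂' * V₁ * V₃) + (N₂' * V₂ * V₃))
        + (D1 (W + N') U₁ U₂ U₃ (N + M) N') * ((W₂ * W₂ * N₂') + 2 * (W₂ * N₂' * N₂') + (N₂' * N₂' * N₂') + (N₂' * V₁ * V₃) + (N₂' * V₂ * V₃))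
        + (Hb (W + N') U₁ U₂ U₃ (N + M)) * ((W₂ * W₂ * W₂) + 2 * (W₂ * W₂ * N₂') + (W₂ * W₂ * V₁) + (W₂ * W₂ * V₂) + (W₂ * W₂ * V₃) + (W₂ * N₂' * N₂') + 2 * (W₂ * N₂' * V₁) + 2 * (W₂ * N₂' * V₂) + 2 * (W₂ * N₂' * V₃) + (W₂ * V₁ * V₂) + (W₂ * V₁ * V₃) + (W₂ * V₂ * V₃) + (N₂' * N₂' * V₁) + (N₂' * N₂' * V₂) + (N₂' * N₂' * V₃) + (N₂' * V₁ * V₂) + (V₁ * V₂ * V₃))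
        + ((W * W * W) + 2 * (W * W * N') + (W * W * U₁) + (W * W * U₂) + (W * W * U₃) + (W * N' * N') + 2 * (W * N' * U₁) + 2 * (W * N' * U₂) + (W * N' * U₃) + (W * U₁ * U₂) + (W * U₁ * U₃) + (W * U₂ * U₃) + (N' * N' * U₁) + (N' * N' * U₂) + (N' * U₁ * U₃) + (N' * U₂ * U₃)) * (Hb (W₂ + N₂') V₁ V₂ V₃ (N₂ + M₂))
        + ((W * W * N') + 2 * (W * N' * N') + (W * N' * U₃) + (N' * N' * N') + (N' * N' * U₃) + (N' * U₁ * U₂)) * (D1 (W₂ + N₂') V₁ V₂ V₃ (N₂ + M₂) N₂')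
        + ((W * N' * U₁) * (N₂' * V₂ * V₃) + (W * N' * U₁) * (N₂' * V₃ * V₃) + (W * N' * U₁) * (N₂' * V₃ * N₂) + (W * N' * U₁) * (N₂' * V₃ * M₂) + (W * N' * U₂) * (N₂' * V₁ * V₃) + (W * N' * U₂) * (N₂' * V₃ * V₃) + (W * N' * U₂) * (N₂' * V₃ * N₂) + (W * N' * U₂) * (N₂' * V₃ * M₂) + (W * N' * U₃) * (W₂ * N₂' * N₂) + (W * N' * U₃) * (W₂ * N₂' * M₂) + (W * N' * U₃) * (N₂' * N₂' * N₂) + (W * N' * U₃) * (N₂' * N₂' * M₂) + 2 * (W * N' * U₃) * (N₂' * V₁ * V₃) + 2 * (W * N' * U₃) * (N₂' * V₂ * V₃) + (W * N' * U₃) * (N₂' * V₃ * N₂) + (W * N' * U₃) * (N₂' * V₃ * M₂) + 2 * (W * N' * N) * (W₂ * N₂' * V₃) + 2 * (W * N' * N) * (N₂' * N₂' * V₃) + (W * N' * N) * (N₂' * V₃ * V₃) + 2 * (W * N' * M) * (W₂ * N₂' * V₃) + 2 * (W * N' * M) * (N₂' * N₂' * V₃) + (W * N' * M) * (N₂' *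 V₃ * V₃) + (N' * N' * U₁) * (N₂' * V₂ * V₃) + (N' * N' * U₁) * (N₂' * V₃ * V₃) + (N' * N' * U₁) * (N₂' * V₃ * N₂) + (N' * N' * U₁) * (N₂' * V₃ * M₂) + (N' * N' * U₂) * (N₂' * V₁ * V₃) + (N' * N' * U₂) * (N₂' * V₃ * V₃) + (N' * N' * U₂) * (N₂' * V₃ * N₂) + (N' * N' * U₂) * (N₂' * V₃ * M₂) + (N' * N' * U₃) * (N₂' * V₁ * V₂) + 3 * (N' * N' * U₃) * (N₂' * V₁ * V₃) + 3 * (N' * N' * U₃) * (N₂' * V₂ * V₃) + (N' * N' * U₃) * (N₂' * V₃ * N₂) + (N' * N' * U₃) * (N₂' * V₃ * M₂) + 2 * (N' * N' * N) * (W₂ * N₂' * V₃) + 2 * (N' * N' * N) * (N₂' * N₂' * V₃) + (N' * N' * N) * (N₂' * V₃ * V₃) + 2 * (N' * N' * M) * (W₂ * N₂' * V₃) + 2 * (N' * N' * M) * (N₂' * N₂' * V₃) + (N' * N' * M) * (N₂' * V₃ * V₃) + (N' * U₁ * U₂) * (N₂' * V₁ * V₃) + (N' * U₁ * U₂) * (N₂'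 * V₂ * V₃) + (N' * U₁ * U₃) * (W₂ * N₂' * V₂) + (N' * U₁ * U₃) * (W₂ * N₂' * N₂) + (N' * U₁ * U₃) * (W₂ * N₂' * M₂) + (N' * U₁ * U₃) * (N₂' * N₂' * V₂) + (N' * U₁ * U₃) * (N₂' * N₂' * N₂) + (N' * U₁ * U₃) * (N₂' * N₂' * M₂) + (N' * U₁ * U₃) * (N₂' * V₁ * V₃) + 2 * (N' * U₁ * U₃) * (N₂' * V₂ * V₃) + (N' * U₁ * U₃) * (N₂' * V₃ * V₃) + 2 * (N' * U₁ * U₃) * (N₂' * V₃ * N₂) + 2 * (N' * U₁ * U₃) * (N₂' * V₃ * M₂) + (N' * U₂ * U₃) * (W₂ * N₂' * V₁) + (N' * U₂ * U₃) * (N₂' * N₂' * V₁) + (N' * U₂ * U₃) * (N₂' * V₁ * V₂) + 3 * (N' * U₂ * U₃) * (N₂' * V₁ * V₃) + 2 * (N' * U₂ * U₃) * (N₂' * V₂ * V₃) + (N' * U₂ * U₃) * (N₂' * V₃ * V₃) + 2 * (N' * U₂ * U₃) * (N₂' * V₃ * N₂) + 2 * (N' * U₂ * U₃) * (N₂' *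 V₃ * M₂) + (N' * U₃ * U₃) * (W₂ * N₂' * V₁) + (N' * U₃ * U₃) * (W₂ * N₂' * V₂) + (N' * U₃ * U₃) * (W₂ * N₂' * N₂) + (N' * U₃ * U₃) * (W₂ * N₂' * M₂) + (N' * U₃ * U₃) * (N₂' * N₂' * V₁) + (N' * U₃ * U₃) * (N₂' * N₂' * V₂) + (N' * U₃ * U₃) * (N₂' * N₂' * N₂) + (N' * U₃ * U₃) * (N₂' * N₂' * M₂) + (N' * U₃ * U₃) * (N₂' * V₁ * V₃) + (N' * U₃ * U₃) * (N₂' * V₂ * V₃) + (N' * U₃ * U₃) * (N₂' * V₃ * N₂) + (N' * U₃ * U₃) * (N₂' * V₃ * M₂) + (N' * U₃ * N) * (W₂ * N₂' * V₁) + (N' * U₃ * N) * (W₂ * N₂' * V₂) + 2 * (N' * U₃ * N) * (W₂ * N₂' * V₃) + (N' * U₃ * N) * (N₂' * N₂' * V₁) + (N' * U₃ * N) * (N₂' * N₂' * V₂) + 2 * (N' * U₃ * N) * (N₂' * N₂' * V₃) + (N' * U₃ * N) * (N₂' * V₁ * V₂) + (N' * U₃ * N) * (N₂' * V₁ * V₃)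 + (N' * U₃ * N) * (N₂' * V₂ * V₃) + (N' * U₃ * N) * (N₂' * V₃ * V₃) + (N' * U₃ * N) * (N₂' * V₃ * N₂) + (N' * U₃ * N) * (N₂' * V₃ * M₂) + (N' * U₃ * M) * (W₂ * N₂' * V₁) + (N' * U₃ * M) * (W₂ * N₂' * V₂) + 2 * (N' * U₃ * M) * (W₂ * N₂' * V₃) + (N' * U₃ * M) * (W₂ * N₂' * N₂) + (N' * U₃ * M) * (W₂ * N₂' * M₂) + (N' * U₃ * M) * (N₂' * N₂' * V₁) + (N' * U₃ * M) * (N₂' * N₂' * V₂) + 2 * (N' * U₃ * M) * (N₂' * N₂' * V₃) + (N' * U₃ * M) * (N₂' * N₂' * N₂) + (N' * U₃ * M) * (N₂' * N₂' * M₂) + (N' * U₃ * M) * (N₂' * V₃ * V₃) + (N' * U₃ * M) * (N₂' * V₃ * N₂) + (N' * U₃ * M) * (N₂' * V₃ * M₂))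
        + ((N' * N' * U₃) + (N' * U₂ * U₃) + (N' * U₃ * N)) * (AG (W₂ + N₂') V₁ V₂ V₃ (N₂ + M₂) * N₂') := by
    subst hzW hzNp hzU₁ hzU₂ hzU₃ hzN hzM
    simp only [D1, Hb, AG]
    ring
  have hR : 0 ≤ 1 * D1 (zW + zN') zU₁ zU₂ zU₃ (zN + zM) zN' := by
    rw [key]
    generalize AG (W + N') U₁ U₂ U₃ (N + M) = A0 at hAGx ⊢
    generalize D1 (W + N') U₁ U₂ U₃ (N + M) N' = A1 at hD1x ⊢
    generalize Hb (W + N') U₁ U₂ U₃ (N + M) = A2 at hHbx ⊢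
    generalize AG (W₂ + N₂') V₁ V₂ V₃ (N₂ + M₂) = A3 at hAGy ⊢
    generalize D1 (W₂ + N₂') V₁ V₂ V₃ (N₂ + M₂) N₂' = A4 at hD1y ⊢
    generalize Hb (W₂ + N₂') V₁ V₂ V₃ (N₂ + M₂) = A5 at hHby ⊢
    positivity
  linarith

end CubicThreePointApex

end Summit.CriticalPhenomena.PercolationContinuityZ3.Theorems
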